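import Summits.QuantumAdvantage.QuantumAdvantage.Theorems.RandomOracleGaugePromiseTransferStubPromiseOracleElimination

/-!
# Crux `PromiseTransfer` (stmt-QuantumAdvantage-10749 / -11702, routes RandomOracleGauge / SpikesNeedAddresses), line `promise_oracle_split` — stub `stub_promiseOracleElimination`

Piece 2 `PromiseOracleElimination` of the split of `PromiseTransfer` (skeleton
`Cruxes/PromiseTransfer/Lines/promise_oracle_split.lean`, registered stub `stub_promiseOracleElimination`):
PROMISE-`BPP'` ORACLE ELIMINATION relative to a random oracle. Its registered signature is, verbatim, the
body of `Sig.stub_promiseOracleElimination` of the sibling crux `TransferPB` (route SosSandwich,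
stmt-QuantumAdvantage-15238), proved in `Theorems/SosSandwichTransferPBStubPromiseOracleElimination.lean`
(Bennett–Gill's coins read off far oracle positions, exponential amplification, union bound); this file
re-exports that theorem for the TWIN SPELLING stmt-QuantumAdvantage-11702 (route SpikesNeedAddresses) of the
same skeleton, in the sub-namespace `SpikesNeedAddresses` (the RandomOracleGauge spelling stmt-10749 is served by
`Theorems/RandomOracleGaugePromiseTransferStubPromiseOracleElimination.lean`).
-/

-- D-0017: single-conjunct summit ⇒ the duplicate `QuantumAdvantage.QuantumAdvantage` is mandated.
set_option linter.dupNamespace false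

noncomputable section

namespace Summit.QuantumAdvantage.QuantumAdvantage.Cruxes.PromiseTransfer.PromiseOracleSplit.SpikesNeedAddresses

open Literature.Computability.Complexity

/-- **Stub `stub_promiseOracleElimination` of the line `promise_oracle_split` of crux `PromiseTransfer`**
(verbatim the registered signature): PROMISE-`BPP'` ORACLE ELIMINATION relative to a random oracle — for
`Q ∈ PromiseBPP'`, a polynomial-time transcript machine `C` with budget `q` consulting `A ⊕ g`, and
polynomials `ℓ, r`, a polynomial-time `C'` with the random oracle alone reproduces every halting run of
`C^{A ⊕ ĝ(A)}(x)`, where `ĝ(A)` reads a finite window of positions longer than `ℓ(|x|)` and violates the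
promise of `Q` with probability `≤ 1/(r(|x|)+1)`. The theorem
`Cruxes.TransferPB.Birth.stub_promiseOracleElimination` of the sibling crux, by name.
[cite: BennettGill1981, Thm. 5] [cite: AroraBarak2009, Thm. 7.10 and §7.4.1] -/
theorem stub_promiseOracleElimination :
  ∀ Q ∈ Literature.Computability.Complexity.PromiseBPP', ∀ (C : OracleAlg Bool) (q : Polynomial ℕ),
    C.IsPolyTime Computability.encodingBoolBool →
    (∀ (O : Oracle) (x : List Bool), ∀ y ∈ C.queries O (q.eval x.length) x, y.length ≤ q.eval x.length) →
    ∀ ℓ r : Polynomial ℕ, ∃ (C' : OracleAlg Bool) (q' : Polynomial ℕ),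
      C'.IsPolyTime Computability.encodingBoolBool ∧
      (∀ (A : Language Bool) (x : List Bool), ∀ y ∈ C'.queries (Oracle.ofLanguage A) (q'.eval x.length) x, y.length ≤ q'.eval x.length) ∧
      ∀ x : List Bool, 1 ≤ x.length →
        ∃ (V : Finset (List Bool)) (ĝ : Set (List Bool) → (List Bool → Bool)),
          (∀ v ∈ V, ℓ.eval x.length < v.length) ∧
          (∀ A : Set (List Bool), ĝ A = ĝ (A ∩ ↑V)) ∧
          (∀ (A : Set (List Bool)) (b : Bool),
            C.run (Oracle.ofLanguage {w : List Bool | ∃ v : List Bool, (w = false :: v ∧ v ∈ A) ∨ (w = true :: v ∧ ĝ A v = true)}) (q.eval x.length) x = some b →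
            C'.run (Oracle.ofLanguage A) (q'.eval x.length) x = some b) ∧
          (ProbabilityTheory.setBernoulli (Set.univ : Set (List Bool)) ⟨1 / 2, by norm_num, by norm_num⟩)
            {A : Set (List Bool) | ¬ ((∀ v ∈ Q.yes, ĝ A v = true) ∧ (∀ v ∈ Q.no, ĝ A v = false))}
            ≤ ENNReal.ofReal (1 / (((r.eval x.length : ℕ) : ℝ) + 1)) :=
  PromiseOracleSplit.stub_promiseOracleElimination

end Summit.QuantumAdvantage.QuantumAdvantage.Cruxes.PromiseTransfer.PromiseOracleSplit.SpikesNeedAddresses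

end
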